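/-
Copyright (c) 2026 the pub-hodgecm-mathlib formalisation cell (harness21).  Prover seat hodgecm-mathlib-K2E3-p03 (g6), Track B «K2-LIT» ∕ h413
(`stmt-HodgeConjecture-24833`), leaf (nsc-S-A′) «principal-block standard span», H-layer brick STD-EMB part 2 (dealer K2E3-plan (g4) D89∕D91, architect
K2E3-p25 (g2) `MEMO-SA-architecture.v2` §1 row STD-EMB, alternative (a)): THE STANDARD MODULE `D(η, ψ) = Ind_{P₂₁}(η∘det₂ ⊠ ψ)` IS DEGENERATE —
`Wh(D(η,ψ)) = 0`.  2026-09-04.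
-/
import Summits.HodgeConjecture.HodgeConjecture.Theorems.K2E3GL3StandardModuleEmbedding            -- ★ STD-EMB part 1 (K2E3-p03): `transvectionUnit_one_zero_mem`, block dets, `isOpen_ker_psiQ`
import Summits.HodgeConjecture.HodgeConjecture.Theorems.K2E3GL2ReducibleInducedDetCharConstituent  -- ★ G2 (K2E3-p25): `twist_comp_leviProjection_apply_eq_one` (inducing datum trivial on `U_Q`)
import Literature.NumberTheory.Automorphic.WhittakerHeredityGL                                      -- ★ Rodier heredity `exists_injective_whittakerFunctionals_smoothIndRep`, `leviWhittakerFunctionals`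
import HarnessLib

/-!
# K2_E3 road (h413), leaf (nsc-S-A′), H-layer brick STD-EMB part 2 — `D(η,ψ)` has no Whittaker functional

Cell `pub/hodgecm-mathlib` (D-0151), Track B, seat K2E3-p03 (g6); architecture K2E3-p25 (g2) `MEMO-SA-architecture.v2` §1 row STD-EMB, the
alternative «NOT surjective because `Wh(D) = 0`», which the C-layer hands (C1′∕C1″, K2E3-p17 (g8)) consume next to ★ HER
`K2E3DegenerateSubquotientHeredity.not_isGeneric_subquotient`.  `--supports stmt-HodgeConjecture-24833 --as helper`; THEOREMS ONLY; COUNT-NEUTRAL.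

CURRENCY (architect's §0∕§1, inline, identical to ★ `K2E3GL3StandardModuleEmbedding`): `M_Q := Π a : Bool, GL {i : Fin 3 // ![false,false,true] i = a} F`,
`ψ_Q η ψ := (η ∘ det ∘ ev_false) · (ψ ∘ det ∘ ev_true)`, `σ_Q := ((𝟙.twist ψ_Q) ∘ proj_Q) ⊗ δ_Q^{1∕2}` (the inducing datum),
`D η ψ := parabolicIndGL F ![false,false,true] (𝟙.twist ψ_Q) = Ind_Q σ_Q`; `ψ₀ : AddChar F Circle` continuous non-trivial, `ψ_U(u) = ψ₀(u₀₁ + u₁₂)`.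

THE MATHEMATICS ([BernsteinZelevinskyASENS1977, Thm. 5.2, §4.7 (Rodier heredity)]; [Zelevinsky1980, §1, Ex. 3.2]; [Rodier1973]).  By heredity
(★ `exists_injective_whittakerFunctionals_smoothIndRep`) the Whittaker functionals of `Ind_Q σ_Q` inject into the «Levi Whittaker functionals» of `σ_Q`:
linear forms `l` on `ℂ` with `l(σ_Q(w₀ m w₀⁻¹) z) = ψ_U(m) l(z)` for `m ∈ A′ = U₃ ∩ P_{revLabel}`.  Taking `m = u₁₂(y)`: `w₀ u₁₂(y) w₀⁻¹ = u₁₀(y)`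
(★ `permGL_rev_mul_transvectionUnit_one_two_mul_inv`) is a unipotent of the Levi `GL₂`, on which `σ_Q` is trivial (`det = 1` on both blocks,
`δ_Q^{1∕2} = 1`), while `ψ_U(u₁₂(y)) = ψ₀(y)`; choosing `y` with `ψ₀(y) ≠ 1` forces `l = 0`.  Hence `Wh(D(η,ψ)) = 0`: `D(η,ψ)` is NOT generic
(and, ★ HER, neither is any of its subquotients).

§1 `transvectionUnit_one_two_mem_cellLeviUnipotent`, `whittakerCharFun_transvectionUnit_one_two`; §2 `sigmaQ_transvectionUnit_one_zero`;
§3 **`leviWhittakerFunctionals_eq_bot`**; §4 **`whittakerFunctionals_eq_bot`**, **`not_isGeneric_D`**.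
HONEST LABEL: HC_CM is proved only modulo the 7 printed citations (2 remaining named inputs: hLiu418 = stmt-HodgeConjecture-24832, h413 =
stmt-HodgeConjecture-24833) until rung 0 closes; count-neutral helper.

References: [BernsteinZelevinskyASENS1977] Bernstein–Zelevinsky, *Induced representations of reductive 𝔭-adic groups I*, Ann. Sci. ÉNS 10 (1977),
§4.7, Thm. 5.2 · [Zelevinsky1980] Zelevinsky, *Induced representations II*, Ann. Sci. ÉNS 13 (1980), §1, Ex. 3.2 · [Rodier1973] F. Rodier, *Whittaker models
for admissible representations of reductive p-adic split groups*, Proc. Sympos. Pure Math. 26 (1973).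
-/

set_option autoImplicit false
set_option linter.dupNamespace false

noncomputable section

open scoped MatrixGroups NNReal
namespace Summit.HodgeConjecture.HodgeConjecture.Cruxes.H413.K2E3GL3StandardModuleDegenerate

open ValuativeRel
open Literature.NumberTheory.Automorphic
open Literature.NumberTheory.GaloisRepresentations Literature.NumberTheory.GaloisRepresentations.IsNonarchimedeanLocalField
open K2E3GL3InductionInStagesEmbedding (monotone_twoOne)
open K2E3GL3StandardModuleEmbedding (transvectionUnit_one_zero_mem det_leviProjection_transvectionUnit_true det_leviProjection_transvectionUnit_false
  isOpen_ker_psiQ)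

/-! ## §1 The root element `u₁₂(y)` of `A′ = U₃ ∩ P_{revLabel}` and its Whittaker character value -/

section Root

variable {F : Type} [Field F]

/-- `u₁₂(y) ∈ A′ = U₃ ⊓ P_{revLabel ![false,false,true]}` (it is upper unitriangular and `w₀ u₁₂(y) w₀⁻¹ = u₁₀(y) ∈ P₂₁`). [cite: BernsteinZelevinskyASENS1977, §4.7] -/
theorem transvectionUnit_one_two_mem_cellLeviUnipotent (y : F) :
    transvectionUnit (n := 3) 1 2 (by decide) y ∈ cellLeviUnipotent (K := F) (![false, false, true] : Fin 3 → Bool) := by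
  rw [mem_cellLeviUnipotent_iff_conj_mem]
  refine ⟨transvectionUnit_mem_upperUnitriangular (by decide) y, ?_⟩
  rw [K2E3GL3MaximalParabolicRelabel.permGL_rev_mul_transvectionUnit_one_two_mul_inv]
  exact transvectionUnit_one_zero_mem y

/-- **`ψ_U(u₁₂(y)) = ψ₀(y)`**: the non-degenerate character `ψ_U(u) = ψ₀(u₀₁ + u₁₂)` on the root element `u₁₂(y)`. [cite: BernsteinZelevinskyASENS1977, §4.7] -/
theorem whittakerCharFun_transvectionUnit_one_two (ψ₀ : AddChar F Circle) (y : F)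
    (h : transvectionUnit (n := 3) 1 2 (by decide) y ∈ upperUnitriangular (Fin 3) F) :
    whittakerCharFun ψ₀ ⟨transvectionUnit (n := 3) 1 2 (by decide) y, h⟩ = ψ₀ y := by
  rw [whittakerCharFun_apply, superdiagSum_def]
  congr 1
  simp only [Fin.sum_univ_three, Fin.val_zero, Fin.val_one, Fin.val_two, K2E3GL3MaximalParabolicRelabel.transvectionUnit_apply]
  norm_num
  rw [Matrix.one_apply_ne (by decide), zero_add]

end Root

/-! ## §2 The inducing datum `σ_Q` is trivial on `u₁₀(y)` -/

section Sigma

variable {F : Type} [Field F] [ValuativeRel F] [TopologicalSpace F] [IsNonarchimedeanLocalField F] (η ψ : Fˣ →* ℂˣ)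

/-- **`σ_Q(u₁₀(y)) = 1`** for the inducing datum `σ_Q = ((𝟙.twist ψ_Q) ∘ proj_Q) ⊗ δ_Q^{1∕2}` of `D(η,ψ)`: both block determinants of `u₁₀(y)` are `1`
(★ `det_leviProjection_transvectionUnit_false∕_true`) and `δ_Q^{1∕2}(u₁₀(y)) = 1` (★ `rootDeltaChar_eq_one_of_transvectionUnit`).
[cite: BernsteinZelevinsky1977, 1.7, §2.3] -/
theorem sigmaQ_transvectionUnit_one_zero (y : F) :
    (Representation.twist (((Representation.trivial ℂ (Π a : Bool, GL {i : Fin 3 // (![false, false, true] : Fin 3 → Bool) i = a} F) ℂ).twist ((η.comp (Matrix.GeneralLinearGroup.det.comp (Pi.evalMonoidHom (fun a : Bool => GL {i : Fin 3 // (![false, false, true] : Fin 3 → Bool) i = a} F) false))) * (ψ.comp (Matrix.GeneralLinearGroup.det.comp (Pi.evalMonoidHom (fun a : Bool => GL {i : Fin 3 // (![false, false, true] : Fin 3 → Bool) i = a} F) true))))).comp (leviProjection F (![false, false, true] : Fin 3 → Bool))) (rootDeltaChar (standardParabolicGL F (![false, false, true] : Fin 3 → Bool))))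
        ⟨transvectionUnit (n := 3) 1 0 (by decide) y, transvectionUnit_one_zero_mem y⟩ = 1 := by
  haveI : IsTopologicalRing F := inferInstance
  have hδ := K2E3GL3CuspidalBlockRestriction.rootDeltaChar_eq_one_of_transvectionUnit F (P := (standardParabolicGL F (![false, false, true] : Fin 3 → Bool)))
    (i := 1) (j := 0) (by decide) (fun z => transvectionUnit_one_zero_mem z) y
  apply LinearMap.ext
  intro z
  simp only [Representation.twist_apply, MonoidHom.coe_comp, Function.comp_apply, Representation.trivial_apply, MonoidHom.mul_apply,
    Pi.evalMonoidHom_apply, hδ, det_leviProjection_transvectionUnit_true, det_leviProjection_transvectionUnit_false, map_one, one_mul,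
    Units.val_one, one_smul, Module.End.one_apply]

/-! ## §3 The Levi Whittaker functionals of `σ_Q` vanish -/

/-- **`leviWhittakerFunctionals(σ_Q, ψ₀) = 0`** for `ψ₀ ≠ 0`: a Levi Whittaker functional `l` satisfies `l(σ_Q(w₀ m w₀⁻¹) z) = ψ_U(m) l(z)` for
`m ∈ A′`; with `m = u₁₂(y)`, `σ_Q(w₀ u₁₂(y) w₀⁻¹) = σ_Q(u₁₀(y)) = 1` (§2) and `ψ_U(u₁₂(y)) = ψ₀(y) ≠ 1` for a suitable `y`, so `l = 0`.
[cite: BernsteinZelevinskyASENS1977, §4.7, Thm. 5.2] [cite: Zelevinsky1980, Ex. 3.2] -/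
theorem leviWhittakerFunctionals_eq_bot {ψ₀ : AddChar F Circle} (hψ₀ : ψ₀ ≠ 0) :
    leviWhittakerFunctionals (![false, false, true] : Fin 3 → Bool)
        (Representation.twist (((Representation.trivial ℂ (Π a : Bool, GL {i : Fin 3 // (![false, false, true] : Fin 3 → Bool) i = a} F) ℂ).twist ((η.comp (Matrix.GeneralLinearGroup.det.comp (Pi.evalMonoidHom (fun a : Bool => GL {i : Fin 3 // (![false, false, true] : Fin 3 → Bool) i = a} F) false))) * (ψ.comp (Matrix.GeneralLinearGroup.det.comp (Pi.evalMonoidHom (fun a : Bool => GL {i : Fin 3 // (![false, false, true] : Fin 3 → Bool) i = a} F) true))))).comp (leviProjection F (![false, false, true] : Fin 3 → Bool))) (rootDeltaChar (standardParabolicGL F (![false, false, true] : Fin 3 → Bool)))) ψ₀ = ⊥ := by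
  obtain ⟨y, hy⟩ := AddChar.ne_zero_iff.1 hψ₀
  have hy' : ((ψ₀ y : Circle) : ℂ) ≠ 1 := fun h => hy (Circle.coe_eq_one.1 h)
  have hconj : (⟨permGL Fin.revPerm * transvectionUnit (n := 3) 1 2 (by decide) y * (permGL Fin.revPerm)⁻¹,
      conj_mem_standardParabolicGL_of_mem_cellLeviUnipotent (![false, false, true] : Fin 3 → Bool)
        (transvectionUnit_one_two_mem_cellLeviUnipotent y)⟩ : ↥(standardParabolicGL F (![false, false, true] : Fin 3 → Bool))) =
      ⟨transvectionUnit (n := 3) 1 0 (by decide) y, transvectionUnit_one_zero_mem y⟩ :=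
    Subtype.ext (K2E3GL3MaximalParabolicRelabel.permGL_rev_mul_transvectionUnit_one_two_mul_inv y)
  rw [Submodule.eq_bot_iff]
  intro l hl
  apply LinearMap.ext
  intro z
  have h := (mem_leviWhittakerFunctionals_iff _ _ ψ₀ l).1 hl _ (transvectionUnit_one_two_mem_cellLeviUnipotent y) z
  rw [hconj, sigmaQ_transvectionUnit_one_zero, Module.End.one_apply,
    whittakerCharFun_transvectionUnit_one_two ψ₀ y (transvectionUnit_mem_upperUnitriangular (by decide) y)] at h
  rw [LinearMap.zero_apply]
  rcases mul_right_eq_self₀.1 ((mul_comm _ _).trans h.symm) with h1 | h0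
  · exact absurd h1 hy'
  · exact h0

/-! ## §4 `Wh(D(η,ψ)) = 0`: the standard module is degenerate -/

/-- **`Wh(D(η,ψ), ψ₀) = 0`** for `ker η`, `ker ψ` open and `ψ₀` continuous non-trivial: Rodier heredity (★ `exists_injective_whittakerFunctionals_smoothIndRep`,
the inducing datum being smooth and trivial on `U_Q`, ★ `twist_comp_leviProjection_apply_eq_one`) injects `Wh(Ind_Q σ_Q)` into `leviWhittakerFunctionals(σ_Q) = 0`
(§3). [cite: BernsteinZelevinskyASENS1977, Thm. 5.2, §4.7] [cite: Zelevinsky1980, Ex. 3.2] -/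
theorem whittakerFunctionals_eq_bot (hη : IsOpen ((η.ker : Subgroup Fˣ) : Set Fˣ)) (hψ : IsOpen ((ψ.ker : Subgroup Fˣ) : Set Fˣ))
    {ψ₀ : AddChar F Circle} (hψ₀ : ψ₀.IsContinuousNontrivial) :
    whittakerFunctionals (Representation.parabolicIndGL F (![false, false, true] : Fin 3 → Bool) ((Representation.trivial ℂ (Π a : Bool, GL {i : Fin 3 // (![false, false, true] : Fin 3 → Bool) i = a} F) ℂ).twist ((η.comp (Matrix.GeneralLinearGroup.det.comp (Pi.evalMonoidHom (fun a : Bool => GL {i : Fin 3 // (![false, false, true] : Fin 3 → Bool) i = a} F) false))) * (ψ.comp (Matrix.GeneralLinearGroup.det.comp (Pi.evalMonoidHom (fun a : Bool => GL {i : Fin 3 // (![false, false, true] : Fin 3 → Bool) i = a} F) true)))))) ψ₀ = ⊥ := by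
  have hσ : ((Representation.trivial ℂ (Π a : Bool, GL {i : Fin 3 // (![false, false, true] : Fin 3 → Bool) i = a} F) ℂ).twist
      ((η.comp (Matrix.GeneralLinearGroup.det.comp (Pi.evalMonoidHom (fun a : Bool => GL {i : Fin 3 // (![false, false, true] : Fin 3 → Bool) i = a} F) false))) * (ψ.comp (Matrix.GeneralLinearGroup.det.comp (Pi.evalMonoidHom (fun a : Bool => GL {i : Fin 3 // (![false, false, true] : Fin 3 → Bool) i = a} F) true))))).IsSmooth := isSmooth_trivial_twist (isOpen_ker_psiQ η ψ hη hψ)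
  obtain ⟨Λ, hΛ⟩ := exists_injective_whittakerFunctionals_smoothIndRep (F := F) (c := (![false, false, true] : Fin 3 → Bool))
    (σ' := (Representation.twist (((Representation.trivial ℂ (Π a : Bool, GL {i : Fin 3 // (![false, false, true] : Fin 3 → Bool) i = a} F) ℂ).twist ((η.comp (Matrix.GeneralLinearGroup.det.comp (Pi.evalMonoidHom (fun a : Bool => GL {i : Fin 3 // (![false, false, true] : Fin 3 → Bool) i = a} F) false))) * (ψ.comp (Matrix.GeneralLinearGroup.det.comp (Pi.evalMonoidHom (fun a : Bool => GL {i : Fin 3 // (![false, false, true] : Fin 3 → Bool) i = a} F) true))))).comp (leviProjection F (![false, false, true] : Fin 3 → Bool))) (rootDeltaChar (standardParabolicGL F (![false, false, true] : Fin 3 → Bool))))) ψ₀ monotone_twoOne hσ.twist_comp_leviProjection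
    (fun p hp => K2E3GL2ReducibleInducedDetCharConstituent.twist_comp_leviProjection_apply_eq_one (![false, false, true] : Fin 3 → Bool) _ p hp) hψ₀
  rw [Submodule.eq_bot_iff]
  intro l hl
  have h1 : Λ ⟨l, hl⟩ = 0 :=
    Subtype.ext ((Submodule.eq_bot_iff _).1 (leviWhittakerFunctionals_eq_bot η ψ hψ₀.2) _ (Λ ⟨l, hl⟩).2)
  have h2 : (⟨l, hl⟩ : ↥(whittakerFunctionals (Representation.parabolicIndGL F (![false, false, true] : Fin 3 → Bool) ((Representation.trivial ℂ (Π a : Bool, GL {i : Fin 3 // (![false, false, true] : Fin 3 → Bool) i = a} F) ℂ).twist ((η.comp (Matrix.GeneralLinearGroup.det.comp (Pi.evalMonoidHom (fun a : Bool => GL {i : Fin 3 // (![false, false, true] : Fin 3 → Bool) i = a} F) false))) * (ψ.comp (Matrix.GeneralLinearGroup.det.comp (Pi.evalMonoidHom (fun a : Bool => GL {i : Fin 3 // (![false, false, true] : Fin 3 → Bool) i = a} F) true)))))) ψ₀)) = 0 :=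
    hΛ (h1.trans (map_zero Λ).symm)
  exact congrArg Subtype.val h2

/-- **BRICK STD-EMB part 2 — `D(η,ψ)` IS NOT GENERIC** (`¬ IsGeneric (D η ψ) ψ₀`, i.e. `Wh(D(η,ψ), ψ₀) = 0`), for characters `η, ψ` with open kernels and
`ψ₀` continuous non-trivial.  With ★ HER (`not_isGeneric_subquotient`) no subquotient of `D(η,ψ)` is generic either. [cite: BernsteinZelevinskyASENS1977, Thm. 5.2, §4.7]
[cite: Zelevinsky1980, §1, Ex. 3.2] -/
theorem not_isGeneric_D (hη : IsOpen ((η.ker : Subgroup Fˣ) : Set Fˣ)) (hψ : IsOpen ((ψ.ker : Subgroup Fˣ) : Set Fˣ))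
    (ψ₀ : AddChar F Circle) (hψ₀ : ψ₀.IsContinuousNontrivial) :
    ¬ IsGeneric (Representation.parabolicIndGL F (![false, false, true] : Fin 3 → Bool) ((Representation.trivial ℂ (Π a : Bool, GL {i : Fin 3 // (![false, false, true] : Fin 3 → Bool) i = a} F) ℂ).twist ((η.comp (Matrix.GeneralLinearGroup.det.comp (Pi.evalMonoidHom (fun a : Bool => GL {i : Fin 3 // (![false, false, true] : Fin 3 → Bool) i = a} F) false))) * (ψ.comp (Matrix.GeneralLinearGroup.det.comp (Pi.evalMonoidHom (fun a : Bool => GL {i : Fin 3 // (![false, false, true] : Fin 3 → Bool) i = a} F) true)))))) ψ₀ :=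
  fun h => h (whittakerFunctionals_eq_bot η ψ hη hψ hψ₀)

end Sigma

end Summit.HodgeConjecture.HodgeConjecture.Cruxes.H413.K2E3GL3StandardModuleDegenerate

end
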